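import Summits.CriticalPhenomena.PercolationContinuityZ3.Theorems.PercNearOneGluingNoHeavyLowerTailOneCutFiveThreePort
import Summits.CriticalPhenomena.PercolationContinuityZ3.Theorems.PercNearOneGluingNoHeavyLowerTailOneCutFiveThreePortAplPoly
import Summits.CriticalPhenomena.PercolationContinuityZ3.Theorems.PercNearOneGluingNoHeavyLowerTailCILOffObserverTransport
import Literature.Probability.Percolation.GladkovThreeClusterDichotomyProofs
import Literature.Probability.Percolation.KozmaNitzanHittable
import Mathlib.Tactic.Linarith
import Mathlib.Tactic.LinearCombination
import Mathlib.Tactic.FieldSimp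
import Mathlib.Tactic.Ring
import HarnessLib

/-!
# `NoHeavyLowerTail` (stmt-CriticalPhenomena-4575), |A| = 5 glued rung — `Z(3,2)` at a THREE-PORT observer follows from
# the apex-pair row APL₁(3/10) for the graph off the observer (part 4 of the three-port series)

Support file (prover seat `prim-ineq-gen-8`, gen 11; `--supports stmt-CriticalPhenomena-4575`; insurance line `Z(3,2)` =
`OneCutFive.ZeroOneThree`).  No definitions, no named facts, no sorries.  Memo:
`run/shared/lean/prim/prim-ineq-gen-8/FINDING-gen11-THREEPORT-APL.md`.

SETTING (as in `…OneCutFiveThreePort`).  `μ = prodBernoulli w` on `Fin n`; `o` a three-port observer onto distinct targets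
`a, b, c ≠ o` (every other pair at `o` has weight `0`); hairs `α, β, γ`; the graph off `o` is ARBITRARY and is the weighted graph
`w ∖ o := fun e => if o ∈ e then 0 else w e` (law `μ' = prodBernoulli (w ∖ o)`).  Five cells of the three-point law of `(a,b,c)`
under `μ'`: `U0 = μ'(a|b|c)`, `Uab = μ'(ab|c)`, `Uac = μ'(ac|b)`, `Ubc = μ'(a|bc)`, `U3 = μ'(abc)`.

HYPOTHESIS APL₁(κ) (the apex-pair LOWER bound, an OPEN three-point inequality — not in print; numerically `κ ≥ 0.76` on every
known family, conjecturally `2/3`, needed here with `κ = 3/10`; nearest printed statement: Gladkov 2024, Thm. 1.3 gives the CUBIC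
rate `U3·U0² ≤ 4·max(Uab, Uac)` [cite: Gladkov2024, Thm. 1.3 (p. 2), Conj. 10.1 (p. 18), arXiv:2408.08457]): at apex `x ∈ {a,b,c}`,
`μ'(x joined to exactly one of the other two) ≥ κ · U0 · U3`.  It enters ONLY as three local hypotheses on `μ'`.

**Theorem (`ThreePort.exists_exchange_of_apl`).**  If all three hairs are `≤ 1/2`, `Σ_v μ(o↔v) ≥ 2`, and APL₁(3/10) holds at
the three apexes for `μ'`, then the pocket exchange `μ(B={v}) ≤ μ(B = the other two)` holds at SOME `v ∈ {a,b,c}`.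
**Corollary (`ThreePort.pocketExchange_of_apl`).**  Under `Σ_v μ(o↔v) ≥ 2` and APL₁(3/10) at the three apexes of `μ'`, the
exchange holds at the weakest vertex `a` (`μ(o↔a) ≤ μ(o↔b), μ(o↔c)`) — the conclusion of `Z(3,2)` at every three-port observer
(heavy hairs: `ThreePort.pocketExchange_of_half_le_hair`, no APL needed; light hairs: this file; transfer to the weakest vertex:
Kozma–Nitzan, `OneCutFive.pocketExchange_of_le_of_exchange` [cite: KozmaNitzan2024, proof of Thm. 2, display (7) (p. 8)]).

PROOF.  `ThreePort.margin_eq` writes the three margins as the bilinear forms `M_a, M_b, M_c` of the polynomial theorem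
`ThreePort.aplPoly` (35 port boxes: 19 exact Handelman certificates of the ttrl lanes cp-lslp / cp-z32min re-checked by `ring`,
16 vacuous, two degenerate strata); rows: `Σ ≥ 2` + `ThreePort.real_openConn(_b,_c)` (`SIG`), Gladkov's Lemma 1.2 for `μ'` at
the three apexes (`gladkov2024_lemma_1_2_prodBernoulli` [cite: Gladkov2024, Lemma 1.2 (2)], multiplied out: `DT`), the APL₁
hypotheses; cells move between `μ` and `μ'` by `Hyperedge.real_reachFunctional_offObserver`.
HONEST LABEL: conditional on the open row APL₁(3/10) (as hypotheses); `Z(3,2)` at a general observer is NOT claimed.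
-/

noncomputable section

namespace Summit.CriticalPhenomena.PercolationContinuityZ3.Theorems

open MeasureTheory Set Literature.Probability.LatticeModels Literature.Probability.Percolation
open scoped Classical BigOperators

variable {n : ℕ}

namespace ThreePort

/-! ### The three-port theorem from APL₁(3/10) -/

section Main

variable (w : Sym2 (Fin n) → unitInterval) (o a b c : Fin n) (hao : a ≠ o) (hbo : b ≠ o) (hco : c ≠ o)
  (hab : a ≠ b) (hac : a ≠ c) (hbc : b ≠ c) (hobs : ∀ u, u ≠ o → u ≠ a → u ≠ b → u ≠ c → w s(o, u) = 0)
include hao hbo hco hab hac hbc hobs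

set_option maxHeartbeats 400000 in
/-- **Exchange at some vertex, from APL₁(3/10) off the observer (light hairs).**  `μ = prodBernoulli w`; `o` a three-port
observer onto distinct `a, b, c` with hairs `≤ 1/2`; `μ' = prodBernoulli (w ∖ o)` the law of the graph off `o`.  If
`Σ_v μ(o↔v) ≥ 2` and, for each apex `x ∈ {a,b,c}`, `μ'(x joined to exactly one of the other two targets) ≥
(3/10)·μ'(a|b|c)·μ'(abc)` (the row APL₁(3/10), OPEN in general — taken as hypotheses), then
`μ(B={a}) ≤ μ(B={b,c})` or `μ(B={b}) ≤ μ(B={a,c})` or `μ(B={c}) ≤ μ(B={a,b})`. [this work] -/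
theorem exists_exchange_of_apl
    (hαh : (w s(o, a) : ℝ) ≤ 1 / 2) (hβh : (w s(o, b) : ℝ) ≤ 1 / 2) (hγh : (w s(o, c) : ℝ) ≤ 1 / 2)
    (hsum : 2 ≤ (prodBernoulli w).real (openConn o a) + (prodBernoulli w).real (openConn o b) +
      (prodBernoulli w).real (openConn o c))
    (hAPLa : (3 / 10 : ℝ) *
        (prodBernoulli fun e => if o ∈ e then (0 : unitInterval) else w e).real
          ((openConn a b)ᶜ ∩ (openConn a c)ᶜ ∩ (openConn b c)ᶜ) *
        (prodBernoulli fun e => if o ∈ e then (0 : unitInterval) else w e).real (openConn a b ∩ openConn a c) ≤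
      (prodBernoulli fun e => if o ∈ e then (0 : unitInterval) else w e).real (openConn a b ∩ (openConn a c)ᶜ) +
        (prodBernoulli fun e => if o ∈ e then (0 : unitInterval) else w e).real (openConn a c ∩ (openConn a b)ᶜ))
    (hAPLb : (3 / 10 : ℝ) *
        (prodBernoulli fun e => if o ∈ e then (0 : unitInterval) else w e).real
          ((openConn a b)ᶜ ∩ (openConn a c)ᶜ ∩ (openConn b c)ᶜ) *
        (prodBernoulli fun e => if o ∈ e then (0 : unitInterval) else w e).real (openConn a b ∩ openConn a c) ≤
      (prodBernoulli fun e => if o ∈ e then (0 : unitInterval) else w e).real (openConn a b ∩ (openConn b c)ᶜ) +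
        (prodBernoulli fun e => if o ∈ e then (0 : unitInterval) else w e).real (openConn b c ∩ (openConn a b)ᶜ))
    (hAPLc : (3 / 10 : ℝ) *
        (prodBernoulli fun e => if o ∈ e then (0 : unitInterval) else w e).real
          ((openConn a b)ᶜ ∩ (openConn a c)ᶜ ∩ (openConn b c)ᶜ) *
        (prodBernoulli fun e => if o ∈ e then (0 : unitInterval) else w e).real (openConn a b ∩ openConn a c) ≤
      (prodBernoulli fun e => if o ∈ e then (0 : unitInterval) else w e).real (openConn a c ∩ (openConn b c)ᶜ) +
        (prodBernoulli fun e => if o ∈ e then (0 : unitInterval) else w e).real (openConn b c ∩ (openConn a c)ᶜ)) :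
    ((prodBernoulli w).real {ω | ω ∈ openConn o a ∧ ω ∉ openConn o b ∧ ω ∉ openConn o c} ≤
        (prodBernoulli w).real {ω | ω ∉ openConn o a ∧ ω ∈ openConn o b ∧ ω ∈ openConn o c}) ∨
    ((prodBernoulli w).real {ω | ω ∈ openConn o b ∧ ω ∉ openConn o a ∧ ω ∉ openConn o c} ≤
        (prodBernoulli w).real {ω | ω ∉ openConn o b ∧ ω ∈ openConn o a ∧ ω ∈ openConn o c}) ∨
    ((prodBernoulli w).real {ω | ω ∈ openConn o c ∧ ω ∉ openConn o a ∧ ω ∉ openConn o b} ≤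
        (prodBernoulli w).real {ω | ω ∉ openConn o c ∧ ω ∈ openConn o a ∧ ω ∈ openConn o b}) := by
  -- exact formulas and margins at the three apexes (before abbreviating)
  have ea := real_openConn w o a b c hao hbo hco hab hac hbc hobs
  have eb := real_openConn_b w o a b c hao hbo hco hab hac hbc hobs
  have ec := real_openConn_c w o a b c hao hbo hco hab hac hbc hobs
  have hobs_b : ∀ u, u ≠ o → u ≠ b → u ≠ a → u ≠ c → w s(o, u) = 0 :=
    fun u huo hub hua huc => hobs u huo hua hub huc
  have hobs_c : ∀ u, u ≠ o → u ≠ c → u ≠ a → u ≠ b → w s(o, u) = 0 :=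
    fun u huo huc hua hub => hobs u huo hua hub huc
  have ma := margin_eq w o a b c hao hbo hco hab hac hbc hobs
  have mb := margin_eq w o b a c hbo hao hco hab.symm hbc hac hobs_b
  have mc := margin_eq w o c a b hco hao hbo hac.symm hbc.symm hab hobs_c
  rw [ea, eb, ec] at hsum
  set μ := prodBernoulli w with hμ
  set μ' := prodBernoulli (fun e => if o ∈ e then (0 : unitInterval) else w e) with hμ'
  -- the three hairs
  set α : ℝ := (w s(o, a) : ℝ) with hα
  set β : ℝ := (w s(o, b) : ℝ) with hβ
  set γ : ℝ := (w s(o, c) : ℝ) with hγ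
  have hα0 : 0 ≤ α := (w s(o, a)).2.1
  have hβ0 : 0 ≤ β := (w s(o, b)).2.1
  have hγ0 : 0 ≤ γ := (w s(o, c)).2.1
  -- the five cells off `o` (under `μ`, configuration restricted off `o`, as in `…ThreePort`)
  set U0 := μ.real {ω | ¬ (openGraph (ω ∩ {e | o ∉ e})).Reachable a b ∧
      ¬ (openGraph (ω ∩ {e | o ∉ e})).Reachable a c ∧ ¬ (openGraph (ω ∩ {e | o ∉ e})).Reachable b c} with hU0
  set Uab := μ.real {ω | (openGraph (ω ∩ {e | o ∉ e})).Reachable a b ∧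
      ¬ (openGraph (ω ∩ {e | o ∉ e})).Reachable a c} with hUab
  set Uac := μ.real {ω | (openGraph (ω ∩ {e | o ∉ e})).Reachable a c ∧
      ¬ (openGraph (ω ∩ {e | o ∉ e})).Reachable a b} with hUac
  set Ubc := μ.real {ω | (openGraph (ω ∩ {e | o ∉ e})).Reachable b c ∧
      ¬ (openGraph (ω ∩ {e | o ∉ e})).Reachable a b} with hUbc
  set U3 := μ.real {ω | (openGraph (ω ∩ {e | o ∉ e})).Reachable a b ∧
      (openGraph (ω ∩ {e | o ∉ e})).Reachable a c} with hU3
  -- transport of the cells to `μ'` (genuine reachability)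
  have t0 : U0 = μ'.real {ω | ¬ (openGraph ω).Reachable a b ∧ ¬ (openGraph ω).Reachable a c ∧
      ¬ (openGraph ω).Reachable b c} :=
    Hyperedge.real_reachFunctional_offObserver w o (fun R => ¬ R a b ∧ ¬ R a c ∧ ¬ R b c)
  have tab : Uab = μ'.real {ω | (openGraph ω).Reachable a b ∧ ¬ (openGraph ω).Reachable a c} :=
    Hyperedge.real_reachFunctional_offObserver w o (fun R => R a b ∧ ¬ R a c)
  have tac : Uac = μ'.real {ω | (openGraph ω).Reachable a c ∧ ¬ (openGraph ω).Reachable a b} :=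
    Hyperedge.real_reachFunctional_offObserver w o (fun R => R a c ∧ ¬ R a b)
  have tbc : Ubc = μ'.real {ω | (openGraph ω).Reachable b c ∧ ¬ (openGraph ω).Reachable a b} :=
    Hyperedge.real_reachFunctional_offObserver w o (fun R => R b c ∧ ¬ R a b)
  have t3 : U3 = μ'.real {ω | (openGraph ω).Reachable a b ∧ (openGraph ω).Reachable a c} :=
    Hyperedge.real_reachFunctional_offObserver w o (fun R => R a b ∧ R a c)
  -- nonnegativity and normalisation
  obtain ⟨hU0n, hUabn, hUacn, hUbcn, hU3n⟩ : 0 ≤ U0 ∧ 0 ≤ Uab ∧ 0 ≤ Uac ∧ 0 ≤ Ubc ∧ 0 ≤ U3 :=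
    ⟨measureReal_nonneg, measureReal_nonneg, measureReal_nonneg, measureReal_nonneg, measureReal_nonneg⟩
  have hone : U0 + Uab + Uac + Ubc + U3 = 1 := by
    rw [t0, tab, tac, tbc, t3]
    have hsplit := real_eq_add_add_of_iff μ' (S := (univ : Set (BondConfig (Fin n))))
      (T := {ω | (openGraph ω).Reachable a b})
      (U := {ω | ¬ (openGraph ω).Reachable a b ∧ (openGraph ω).Reachable a c})
      (W := {ω | ¬ (openGraph ω).Reachable a b ∧ ¬ (openGraph ω).Reachable a c})
      (fun ω => by simp only [mem_univ, mem_setOf_eq, true_iff]; tauto)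
      (fun ω h1 h2 => h2.1 h1) (fun ω h1 h2 => h2.1 h1) (fun ω h1 h2 => h2.2 h1.2)
    rw [probReal_univ, real_Rab μ' (fun ω => openGraph ω) a b c,
      real_notR_notR μ' (fun ω => openGraph ω) a b c] at hsplit
    have e : {ω : BondConfig (Fin n) | ¬ (openGraph ω).Reachable a b ∧ (openGraph ω).Reachable a c} =
        {ω | (openGraph ω).Reachable a c ∧ ¬ (openGraph ω).Reachable a b} := by
      ext ω; simp only [mem_setOf_eq]; tauto
    rw [e] at hsplit
    linarith
  -- row SIG from `Σ ≥ 2` and the exact formulas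
  have hS : 0 ≤ (U0 * α + Uab * (1 - (1 - α) * (1 - β)) + Uac * (1 - (1 - α) * (1 - γ)) + Ubc * α +
        U3 * (1 - (1 - α) * (1 - β) * (1 - γ))) +
      (U0 * β + Uab * (1 - (1 - α) * (1 - β)) + Uac * β + Ubc * (1 - (1 - β) * (1 - γ)) +
        U3 * (1 - (1 - α) * (1 - β) * (1 - γ))) +
      (U0 * γ + Uab * γ + Uac * (1 - (1 - α) * (1 - γ)) + Ubc * (1 - (1 - β) * (1 - γ)) +
        U3 * (1 - (1 - α) * (1 - β) * (1 - γ))) - 2 * (U0 + Uab + Uac + Ubc + U3) := by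
    linear_combination hsum - (α + β + γ - 2) * hone
  -- the `μ'`-sets of Gladkov's lemma and of the APL hypotheses, as cells
  have sT : ((openConn a b)ᶜ ∩ (openConn a c)ᶜ ∩ (openConn b c)ᶜ : Set (BondConfig (Fin n))) =
      {ω | ¬ (openGraph ω).Reachable a b ∧ ¬ (openGraph ω).Reachable a c ∧ ¬ (openGraph ω).Reachable b c} := by
    ext ω; simp only [mem_inter_iff, mem_compl_iff, mem_setOf_eq, openConn]; tauto
  have s3 : (openConn a b ∩ openConn a c : Set (BondConfig (Fin n))) =
      {ω | (openGraph ω).Reachable a b ∧ (openGraph ω).Reachable a c} := by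
    ext ω; simp only [mem_inter_iff, mem_setOf_eq, openConn]
  have sab : (openConn a b ∩ (openConn a c)ᶜ : Set (BondConfig (Fin n))) =
      {ω | (openGraph ω).Reachable a b ∧ ¬ (openGraph ω).Reachable a c} := by
    ext ω; simp only [mem_inter_iff, mem_compl_iff, mem_setOf_eq, openConn]
  have sac : (openConn a c ∩ (openConn a b)ᶜ : Set (BondConfig (Fin n))) =
      {ω | (openGraph ω).Reachable a c ∧ ¬ (openGraph ω).Reachable a b} := by
    ext ω; simp only [mem_inter_iff, mem_compl_iff, mem_setOf_eq, openConn]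
  have sbc : (openConn b c ∩ (openConn a b)ᶜ : Set (BondConfig (Fin n))) =
      {ω | (openGraph ω).Reachable b c ∧ ¬ (openGraph ω).Reachable a b} := by
    ext ω; simp only [mem_inter_iff, mem_compl_iff, mem_setOf_eq, openConn]
  have sab' : (openConn a b ∩ (openConn b c)ᶜ : Set (BondConfig (Fin n))) =
      {ω | (openGraph ω).Reachable a b ∧ ¬ (openGraph ω).Reachable a c} := by
    ext ω; simp only [mem_inter_iff, mem_compl_iff, mem_setOf_eq, openConn]
    constructor
    · rintro ⟨h1, h2⟩; exact ⟨h1, fun h3 => h2 (h1.symm.trans h3)⟩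
    · rintro ⟨h1, h2⟩; exact ⟨h1, fun h3 => h2 (h1.trans h3)⟩
  have sac' : (openConn a c ∩ (openConn b c)ᶜ : Set (BondConfig (Fin n))) =
      {ω | (openGraph ω).Reachable a c ∧ ¬ (openGraph ω).Reachable a b} := by
    ext ω; simp only [mem_inter_iff, mem_compl_iff, mem_setOf_eq, openConn]
    constructor
    · rintro ⟨h1, h2⟩; exact ⟨h1, fun h3 => h2 (h3.symm.trans h1)⟩
    · rintro ⟨h1, h2⟩; exact ⟨h1, fun h3 => h2 (h1.trans h3.symm)⟩
  have sbc' : (openConn b c ∩ (openConn a c)ᶜ : Set (BondConfig (Fin n))) =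
      {ω | (openGraph ω).Reachable b c ∧ ¬ (openGraph ω).Reachable a b} := by
    ext ω; simp only [mem_inter_iff, mem_compl_iff, mem_setOf_eq, openConn]
    constructor
    · rintro ⟨h1, h2⟩; exact ⟨h1, fun h3 => h2 (h3.trans h1)⟩
    · rintro ⟨h1, h2⟩; exact ⟨h1, fun h3 => h2 (h3.trans h1.symm)⟩
  -- iso-sets
  have sIa : ((openConn a b)ᶜ ∩ (openConn a c)ᶜ : Set (BondConfig (Fin n))) =
      {ω | ¬ (openGraph ω).Reachable a b ∧ ¬ (openGraph ω).Reachable a c} := by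
    ext ω; simp only [mem_inter_iff, mem_compl_iff, mem_setOf_eq, openConn]
  have sIb : ((openConn a b)ᶜ ∩ (openConn b c)ᶜ : Set (BondConfig (Fin n))) =
      {ω | ¬ (openGraph ω).Reachable b a ∧ ¬ (openGraph ω).Reachable b c} := by
    ext ω; simp only [mem_inter_iff, mem_compl_iff, mem_setOf_eq, openConn]
    exact ⟨fun ⟨h1, h2⟩ => ⟨fun h => h1 h.symm, h2⟩, fun ⟨h1, h2⟩ => ⟨fun h => h1 h.symm, h2⟩⟩
  have sIc : ((openConn a c)ᶜ ∩ (openConn b c)ᶜ : Set (BondConfig (Fin n))) =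
      {ω | ¬ (openGraph ω).Reachable c a ∧ ¬ (openGraph ω).Reachable c b} := by
    ext ω; simp only [mem_inter_iff, mem_compl_iff, mem_setOf_eq, openConn]
    exact ⟨fun ⟨h1, h2⟩ => ⟨fun h => h1 h.symm, fun h => h2 h.symm⟩,
      fun ⟨h1, h2⟩ => ⟨fun h => h1 h.symm, fun h => h2 h.symm⟩⟩
  have hIa : μ'.real ((openConn a b)ᶜ ∩ (openConn a c)ᶜ) = Ubc + U0 := by
    rw [sIa, real_notR_notR μ' (fun ω => openGraph ω) a b c, tbc, t0]
  have hIb : μ'.real ((openConn a b)ᶜ ∩ (openConn b c)ᶜ) = Uac + U0 := by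
    rw [sIb, real_notR_notR μ' (fun ω => openGraph ω) b a c, tac, t0]
    congr 1
    · congr 1; ext ω; simp only [mem_setOf_eq]
      exact ⟨fun ⟨h1, h2⟩ => ⟨h1, fun h => h2 h.symm⟩, fun ⟨h1, h2⟩ => ⟨h1, fun h => h2 h.symm⟩⟩
    · congr 1; ext ω; simp only [mem_setOf_eq]
      exact ⟨fun ⟨h1, h2, h3⟩ => ⟨fun h => h1 h.symm, h3, h2⟩, fun ⟨h1, h2, h3⟩ => ⟨fun h => h1 h.symm, h3, h2⟩⟩
  have hIc : μ'.real ((openConn a c)ᶜ ∩ (openConn b c)ᶜ) = Uab + U0 := by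
    rw [sIc, real_notR_notR μ' (fun ω => openGraph ω) c a b, tab, t0]
    congr 1
    · congr 1; ext ω; simp only [mem_setOf_eq]
      exact ⟨fun ⟨h1, h2⟩ => ⟨h1, fun h => h2 h.symm⟩, fun ⟨h1, h2⟩ => ⟨h1, fun h => h2 h.symm⟩⟩
    · congr 1; ext ω; simp only [mem_setOf_eq]
      exact ⟨fun ⟨h1, h2, h3⟩ => ⟨h3, fun h => h1 h.symm, fun h => h2 h.symm⟩,
        fun ⟨h1, h2, h3⟩ => ⟨fun h => h2 h.symm, fun h => h3 h.symm, h1⟩⟩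
  -- the tri-set in the three labellings
  have hT : μ'.real ((openConn a b)ᶜ ∩ (openConn a c)ᶜ ∩ (openConn b c)ᶜ) = U0 := by rw [sT, t0]
  have hTb : μ'.real ((openConn b a)ᶜ ∩ (openConn b c)ᶜ ∩ (openConn a c)ᶜ) = U0 := by
    rw [openConn_comm b a, ← hT]; congr 1; ext ω
    simp only [mem_inter_iff, mem_compl_iff]; tauto
  have hTc : μ'.real ((openConn c a)ᶜ ∩ (openConn c b)ᶜ ∩ (openConn a b)ᶜ) = U0 := by
    rw [openConn_comm c a, openConn_comm c b, ← hT]; congr 1; ext ω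
    simp only [mem_inter_iff, mem_compl_iff]; tauto
  -- Gladkov's Lemma 1.2 at the three apexes, as polynomial rows
  have gA := gladkov2024_lemma_1_2_prodBernoulli (fun e => if o ∈ e then (0 : unitInterval) else w e) a b c
  have gB := gladkov2024_lemma_1_2_prodBernoulli (fun e => if o ∈ e then (0 : unitInterval) else w e) b a c
  have gC := gladkov2024_lemma_1_2_prodBernoulli (fun e => if o ∈ e then (0 : unitInterval) else w e) c a b
  rw [← hμ'] at gA gB gC
  rw [hT, hIb, hIc, hIa] at gA
  rw [hTb, openConn_comm b a, hIa, Set.inter_comm (openConn b c)ᶜ (openConn a c)ᶜ, hIc, hIb] at gB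
  rw [hTc, openConn_comm c a, openConn_comm c b, Set.inter_comm (openConn a c)ᶜ (openConn a b)ᶜ, hIa,
    Set.inter_comm (openConn b c)ᶜ (openConn a b)ᶜ, hIb, hIc] at gC
  have hDa : 0 ≤ (U0 * (U0 + Uab + Uac + Ubc + U3) + (U0 + Ubc) * (U0 + Ubc)) * ((U0 + Uac) * (U0 + Uab)) -
      (U0 * U0 * ((U0 + Uac) + (U0 + Uab))) * (U0 + Uab + Uac + Ubc + U3) := by
    have h := dt_poly_of_div hU0n (ib := Uac + U0) (ic := Uab + U0) (ia := Ubc + U0) (by linarith) (by linarith) gA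
    rw [hone]; linear_combination h
  have hDb : 0 ≤ (U0 * (U0 + Uab + Uac + Ubc + U3) + (U0 + Uac) * (U0 + Uac)) * ((U0 + Ubc) * (U0 + Uab)) -
      (U0 * U0 * ((U0 + Ubc) + (U0 + Uab))) * (U0 + Uab + Uac + Ubc + U3) := by
    have h := dt_poly_of_div hU0n (ib := Ubc + U0) (ic := Uab + U0) (ia := Uac + U0) (by linarith) (by linarith) gB
    rw [hone]; linear_combination h
  have hDc : 0 ≤ (U0 * (U0 + Uab + Uac + Ubc + U3) + (U0 + Uab) * (U0 + Uab)) * ((U0 + Ubc) * (U0 + Uac)) -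
      (U0 * U0 * ((U0 + Ubc) + (U0 + Uac))) * (U0 + Uab + Uac + Ubc + U3) := by
    have h := dt_poly_of_div hU0n (ib := Ubc + U0) (ic := Uac + U0) (ia := Uab + U0) (by linarith) (by linarith) gC
    rw [hone]; linear_combination h
  -- the APL rows
  rw [hT, s3, ← t3, sab, ← tab, sac, ← tac] at hAPLa
  rw [hT, s3, ← t3, sab', ← tab, sbc, ← tbc] at hAPLb
  rw [hT, s3, ← t3, sac', ← tac, sbc', ← tbc] at hAPLc
  have hAa : 0 ≤ (Uab + Uac) * (U0 + Uab + Uac + Ubc + U3) - (3 : ℝ) / 10 * (U0 * U3) := by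
    rw [hone]; linarith
  have hAb : 0 ≤ (Uab + Ubc) * (U0 + Uab + Uac + Ubc + U3) - (3 : ℝ) / 10 * (U0 * U3) := by
    rw [hone]; linarith
  have hAc : 0 ≤ (Uac + Ubc) * (U0 + Uab + Uac + Ubc + U3) - (3 : ℝ) / 10 * (U0 * U3) := by
    rw [hone]; linarith
  -- the polynomial theorem
  have hP := aplPoly U0 Uab Uac Ubc U3 α β γ hU0n hUabn hUacn hUbcn hU3n hone hα0 hαh hβ0 hβh hγ0 hγh
    hS hDa hDb hDc hAa hAb hAc
  -- cells of the `b`- and `c`-labelled margins in the `a`-dictionary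
  have eU0b : μ.real {ω | ¬ (openGraph (ω ∩ {e | o ∉ e})).Reachable b a ∧
      ¬ (openGraph (ω ∩ {e | o ∉ e})).Reachable b c ∧ ¬ (openGraph (ω ∩ {e | o ∉ e})).Reachable a c} = U0 := by
    rw [hU0]; congr 1; ext ω; simp only [mem_setOf_eq]
    exact ⟨fun ⟨h1, h2, h3⟩ => ⟨fun h => h1 h.symm, h3, h2⟩, fun ⟨h1, h2, h3⟩ => ⟨fun h => h1 h.symm, h3, h2⟩⟩
  have eUbcb : μ.real {ω | (openGraph (ω ∩ {e | o ∉ e})).Reachable a c ∧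
      ¬ (openGraph (ω ∩ {e | o ∉ e})).Reachable b a} = Uac := by
    rw [hUac]; congr 1; ext ω; simp only [mem_setOf_eq]
    exact ⟨fun ⟨h1, h2⟩ => ⟨h1, fun h => h2 h.symm⟩, fun ⟨h1, h2⟩ => ⟨h1, fun h => h2 h.symm⟩⟩
  have eU0c : μ.real {ω | ¬ (openGraph (ω ∩ {e | o ∉ e})).Reachable c a ∧
      ¬ (openGraph (ω ∩ {e | o ∉ e})).Reachable c b ∧ ¬ (openGraph (ω ∩ {e | o ∉ e})).Reachable a b} = U0 := by
    rw [hU0]; congr 1; ext ω; simp only [mem_setOf_eq]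
    exact ⟨fun ⟨h1, h2, h3⟩ => ⟨h3, fun h => h1 h.symm, fun h => h2 h.symm⟩,
      fun ⟨h1, h2, h3⟩ => ⟨fun h => h2 h.symm, fun h => h3 h.symm, h1⟩⟩
  have eUbcc : μ.real {ω | (openGraph (ω ∩ {e | o ∉ e})).Reachable a b ∧
      ¬ (openGraph (ω ∩ {e | o ∉ e})).Reachable c a} = Uab := by
    rw [hUab]; congr 1; ext ω; simp only [mem_setOf_eq]
    exact ⟨fun ⟨h1, h2⟩ => ⟨h1, fun h => h2 h.symm⟩, fun ⟨h1, h2⟩ => ⟨h1, fun h => h2 h.symm⟩⟩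
  rw [eU0b, eUbcb] at mb
  rw [eU0c, eUbcc] at mc
  rcases hP with h | h | h
  · left; linarith [ma, h]
  · right; left; linarith [mb, h]
  · right; right; linarith [mc, h]

/-- **`Z(3,2)`'s conclusion at a three-port observer, from APL₁(3/10) off the observer.**  `μ = prodBernoulli w`; `o` a
three-port observer onto distinct `a, b, c` (graph off `o` arbitrary, `μ' = prodBernoulli (w ∖ o)`); `Σ_v μ(o↔v) ≥ 2`;
`a` the weakest target (`μ(o↔a) ≤ μ(o↔b), μ(o↔c)`); APL₁(3/10) at the three apexes of `μ'` (OPEN row, as hypotheses).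
Then `μ(B={a}) ≤ μ(B={b,c})`.  Heavy hairs: `pocketExchange_of_half_le_hair` (no APL); light hairs:
`exists_exchange_of_apl` + Kozma–Nitzan's transfer to the weakest vertex. [this work] -/
theorem pocketExchange_of_apl
    (hsum : 2 ≤ (prodBernoulli w).real (openConn o a) + (prodBernoulli w).real (openConn o b) +
      (prodBernoulli w).real (openConn o c))
    (hqab : (prodBernoulli w).real (openConn o a) ≤ (prodBernoulli w).real (openConn o b))
    (hqac : (prodBernoulli w).real (openConn o a) ≤ (prodBernoulli w).real (openConn o c))
    (hAPLa : (3 / 10 : ℝ) *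
        (prodBernoulli fun e => if o ∈ e then (0 : unitInterval) else w e).real
          ((openConn a b)ᶜ ∩ (openConn a c)ᶜ ∩ (openConn b c)ᶜ) *
        (prodBernoulli fun e => if o ∈ e then (0 : unitInterval) else w e).real (openConn a b ∩ openConn a c) ≤
      (prodBernoulli fun e => if o ∈ e then (0 : unitInterval) else w e).real (openConn a b ∩ (openConn a c)ᶜ) +
        (prodBernoulli fun e => if o ∈ e then (0 : unitInterval) else w e).real (openConn a c ∩ (openConn a b)ᶜ))
    (hAPLb : (3 / 10 : ℝ) *
        (prodBernoulli fun e => if o ∈ e then (0 : unitInterval) else w e).real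
          ((openConn a b)ᶜ ∩ (openConn a c)ᶜ ∩ (openConn b c)ᶜ) *
        (prodBernoulli fun e => if o ∈ e then (0 : unitInterval) else w e).real (openConn a b ∩ openConn a c) ≤
      (prodBernoulli fun e => if o ∈ e then (0 : unitInterval) else w e).real (openConn a b ∩ (openConn b c)ᶜ) +
        (prodBernoulli fun e => if o ∈ e then (0 : unitInterval) else w e).real (openConn b c ∩ (openConn a b)ᶜ))
    (hAPLc : (3 / 10 : ℝ) *
        (prodBernoulli fun e => if o ∈ e then (0 : unitInterval) else w e).real
          ((openConn a b)ᶜ ∩ (openConn a c)ᶜ ∩ (openConn b c)ᶜ) *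
        (prodBernoulli fun e => if o ∈ e then (0 : unitInterval) else w e).real (openConn a b ∩ openConn a c) ≤
      (prodBernoulli fun e => if o ∈ e then (0 : unitInterval) else w e).real (openConn a c ∩ (openConn b c)ᶜ) +
        (prodBernoulli fun e => if o ∈ e then (0 : unitInterval) else w e).real (openConn b c ∩ (openConn a c)ᶜ)) :
    (prodBernoulli w).real {ω | ω ∈ openConn o a ∧ ω ∉ openConn o b ∧ ω ∉ openConn o c} ≤
      (prodBernoulli w).real {ω | ω ∉ openConn o a ∧ ω ∈ openConn o b ∧ ω ∈ openConn o c} := by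
  by_cases hheavy : (1 / 2 : ℝ) ≤ w s(o, a) ∨ (1 / 2 : ℝ) ≤ w s(o, b) ∨ (1 / 2 : ℝ) ≤ w s(o, c)
  · exact pocketExchange_of_half_le_hair w o a b c hao hbo hco hab hac hbc hobs hheavy hqab hqac
  push Not at hheavy
  obtain ⟨ha', hb', hc'⟩ := hheavy
  have hex := exists_exchange_of_apl w o a b c hao hbo hco hab hac hbc hobs ha'.le hb'.le hc'.le hsum hAPLa hAPLb hAPLc
  rcases hex with h | h | h
  · exact h
  · exact OneCutFive.pocketExchange_of_le_of_exchange w o a b c hqab h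
  · have hca := OneCutFive.pocketExchange_of_le_of_exchange w o a c b hqac h
    have e1 : {ω : BondConfig (Fin n) | ω ∈ openConn o a ∧ ω ∉ openConn o c ∧ ω ∉ openConn o b} =
        {ω | ω ∈ openConn o a ∧ ω ∉ openConn o b ∧ ω ∉ openConn o c} := by
      ext ω; simp only [mem_setOf_eq]; tauto
    have e2 : {ω : BondConfig (Fin n) | ω ∉ openConn o a ∧ ω ∈ openConn o c ∧ ω ∈ openConn o b} =
        {ω | ω ∉ openConn o a ∧ ω ∈ openConn o b ∧ ω ∈ openConn o c} := by
      ext ω; simp only [mem_setOf_eq]; tauto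
    rw [e1, e2] at hca
    exact hca

omit hao hbo hco hab hac hbc hobs in
/-- **Three-port `Z(3,2)` from the GLOBAL apex-pair row.**  If APL₁(3/10) holds for EVERY finite weighted graph and every
ordered triple of vertices (`(3/10)·P(x|y|z)·P(xyz) ≤ P(x joined to exactly one of y, z)` — an OPEN three-point inequality,
conjectured with constant `2/3`; Gladkov 2024 Thm. 1.3 is its cubic-rate version), then at every three-port observer the
conclusion of `Z(3,2)` (`OneCutFive.ZeroOneThree`) holds: `Σ_v μ(o↔v) ≥ 2` and `a` weakest imply `μ(B={a}) ≤ μ(B={b,c})`.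
[this work; cite: Gladkov2024, Thm. 1.3 (p. 2), Conj. 10.1 (p. 18)] -/
theorem pocketExchange_of_forall_apl
    (hAPL : ∀ (m : ℕ) (u : Sym2 (Fin m) → unitInterval) (x y z : Fin m), (3 / 10 : ℝ) *
        (prodBernoulli u).real ((openConn x y)ᶜ ∩ (openConn x z)ᶜ ∩ (openConn y z)ᶜ) *
        (prodBernoulli u).real (openConn x y ∩ openConn x z) ≤
      (prodBernoulli u).real (openConn x y ∩ (openConn x z)ᶜ) + (prodBernoulli u).real (openConn x z ∩ (openConn x y)ᶜ))
    (w : Sym2 (Fin n) → unitInterval) (o a b c : Fin n) (hao : a ≠ o) (hbo : b ≠ o) (hco : c ≠ o)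
    (hab : a ≠ b) (hac : a ≠ c) (hbc : b ≠ c) (hobs : ∀ u, u ≠ o → u ≠ a → u ≠ b → u ≠ c → w s(o, u) = 0)
    (hsum : 2 ≤ (prodBernoulli w).real (openConn o a) + (prodBernoulli w).real (openConn o b) +
      (prodBernoulli w).real (openConn o c))
    (hqab : (prodBernoulli w).real (openConn o a) ≤ (prodBernoulli w).real (openConn o b))
    (hqac : (prodBernoulli w).real (openConn o a) ≤ (prodBernoulli w).real (openConn o c)) :
    (prodBernoulli w).real {ω | ω ∈ openConn o a ∧ ω ∉ openConn o b ∧ ω ∉ openConn o c} ≤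
      (prodBernoulli w).real {ω | ω ∉ openConn o a ∧ ω ∈ openConn o b ∧ ω ∈ openConn o c} := by
  set u : Sym2 (Fin n) → unitInterval := fun e => if o ∈ e then (0 : unitInterval) else w e with hu
  have hA := hAPL n u a b c
  have hB := hAPL n u b a c
  have hC := hAPL n u c a b
  -- relabel the `b`- and `c`-instances into the `a`-dictionary
  have eT1 : ((openConn b a)ᶜ ∩ (openConn b c)ᶜ ∩ (openConn a c)ᶜ : Set (BondConfig (Fin n))) =
      (openConn a b)ᶜ ∩ (openConn a c)ᶜ ∩ (openConn b c)ᶜ := by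
    rw [openConn_comm b a]; ext ω; simp only [mem_inter_iff, mem_compl_iff]; tauto
  have eT2 : ((openConn c a)ᶜ ∩ (openConn c b)ᶜ ∩ (openConn a b)ᶜ : Set (BondConfig (Fin n))) =
      (openConn a b)ᶜ ∩ (openConn a c)ᶜ ∩ (openConn b c)ᶜ := by
    rw [openConn_comm c a, openConn_comm c b]; ext ω; simp only [mem_inter_iff, mem_compl_iff]; tauto
  have e31 : (openConn b a ∩ openConn b c : Set (BondConfig (Fin n))) = openConn a b ∩ openConn a c := by
    ext ω; simp only [mem_inter_iff, openConn, mem_setOf_eq]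
    constructor
    · rintro ⟨h1, h2⟩; exact ⟨h1.symm, h1.symm.trans h2⟩
    · rintro ⟨h1, h2⟩; exact ⟨h1.symm, h1.symm.trans h2⟩
  have e32 : (openConn c a ∩ openConn c b : Set (BondConfig (Fin n))) = openConn a b ∩ openConn a c := by
    ext ω; simp only [mem_inter_iff, openConn, mem_setOf_eq]
    constructor
    · rintro ⟨h1, h2⟩; exact ⟨h1.symm.trans h2, h1.symm⟩
    · rintro ⟨h1, h2⟩; exact ⟨h2.symm, h2.symm.trans h1⟩
  rw [eT1, e31, openConn_comm b a] at hB
  rw [eT2, e32, openConn_comm c a, openConn_comm c b] at hC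
  exact pocketExchange_of_apl w o a b c hao hbo hco hab hac hbc hobs hsum hqab hqac hA hB hC

end Main

end ThreePort

end Summit.CriticalPhenomena.PercolationContinuityZ3.Theorems

end
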